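import Summits.ABC.ABC.Theses.TwistAmplification
import Summits.ABC.ABC.Theorems.SomeWindowSaving.Negative.WindowFinite
import Summits.ABC.ABC.Theorems.SomeWindowSaving.Negative.LoadBearing
import Summits.ABC.ABC.Theorems.SomeWindowSaving.Negative.WindowSavingBelowThird
import Summits.ABC.ABC.Theorems.SomeWindowSaving.Negative.LowerLaw
import Summits.ABC.ABC.Theorems.SomeWindowSaving.Negative.LowerLawSmallSigma
import Summits.ABC.ABC.Theorems.TwistAmplificationSomeWindowSavingZagierSilvermanBridgeSemistable
import Summits.ABC.ABC.Theorems.TwistAmplificationSomeWindowSavingInertBox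
import Summits.ABC.ABC.Theorems.TwistAmplificationTwistAmplificationLemma
import Summits.ABC.ABC.Theorems.TwistAmplificationSomeWindowSavingTwistConductorDvd
import Summits.ABC.ABC.Theorems.TwistAmplificationSomeWindowSavingTwistSizeTransfer
import Summits.ABC.ABC.Theorems.TwistAmplificationSomeWindowSavingTwistTransferSzpiro
import Summits.ABC.ABC.Theorems.TwistAmplificationSomeWindowSavingQuadraticTwistInvariants
import Literature.NumberTheory.EllipticCurves.SzpiroFreyProofs
import Literature.NumberTheory.DiophantineGeometry.LocalReductionProofs

/-!
# Skeleton line `polynomial-degree-suffices` for crux `SomeWindowSaving` (stmt-ABC-1976)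
# — LEAD-2 RESHAPE (prover-line-stmt-ABC-1976-2, 2026-08-16): the additive upgrade cut at the twist seam,
#   plus the calibration stub that makes `crux ↔ cofinite weak generalized Szpiro` unconditional

Route `TwistAmplification`, crux r3 `SomeWindowSaving` =
`∃ κ σ δ C, 3 < κ < σ ∧ δ < (σ−κ)/(2σ−6) ∧ ∀ X ≥ 1, T⁺_[κ,σ](X) ≤ C·X^δ`
(`T⁺` = number of reduced global minimal models `W₀/ℤ`, `c₄c₆ ≠ 0`, conductor `N ≤ X`,
`N^κ ≤ M⁺ := max(|Δ|,|c₄|³) ≤ N^σ`; `Negative.windowSet` / `windowCount`, `someWindowSaving_iff`).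

## History of the line (leads 0, 1) — what is LANDED
* bridge (stub 2'): `Summit.ABC.ABC.Theorems.stub_zagierSilvermanBridgeSemistable` (p73891) —
  `PolyDegreeSemistable → WGS_semistable`, imported (no longer inlined).
* InertBox: `Summit.ABC.ABC.Theorems.someWindowSaving_of_weakGenSzpiro`,
  `…someWindowSaving_of_cofiniteWeakGenSzpiro` (p76658), imported.
* support 1978: `Summit.ABC.ABC.Theorems.twistAmplificationLemma_proof` (p80304), imported.

## LEAD-2 RESHAPE (this file; composition idea unchanged: degree bound ⟹ WGS ⟹ inert box)

  `PolyDegreeSemistable →[bridge, LANDED] WGS_ss →[stubs T1,T2,T3: twist transfer ∪ stub R: residue] WGS_all →[InertBox, LANDED] crux`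

* `stub_polyDegreeSemistable` (A; UNCHANGED signature; XL; verdict on file: stub-blocked on stmt-ABC-2046
  given stmt-ABC-2045 — IsogenyGlueCongruence's waypoint; not duplicated here).
* STATUS after wave 1 (lead-2, 2026-08-16T07:00Z): T1 LANDED p85937, T2 LANDED p85638, T3 LANDED p85633,
  Q LANDED p87180 (+ `quadraticTwistInvariants_proof` closing stmt-ABC-1977); open: A (blocked stmt-ABC-2046), R (open core).
* TWIST TRANSFER, cut in three registered stubs (all NEW, all PROVABLE NOW from the tree's
  unramified-twist API `twistModel`, `isMinimalAt_twistModel`, `conductorExponent_twistModel`,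
  `conductorExponent_smul'`, `exists_baseChange_int_forall_isMinimalAt`; fanned out in one wave):
  - `stub_twistConductorDvd` (T1, M): for `d ≡ 1 (mod 4)` with `d² ∣ N(E)` and `E^{(d)}` semistable,
    `N(E^{(d)}) ∣ N(E)` (prime by prime: `f_p` equal at `p ∤ d`, `≤ 1 < 2 ≤ v_p(N)` at `p ∣ d`);
  - `stub_twistSizeTransfer` (T2, M/L): if `W₀` is minimal and `W'/ℤ` is ANY integral model of `E^{(d)}`
    (`C • E^{(d)} = W' ⊗ ℚ`), then `|Δ(W₀)| ≤ |d|⁶|Δ(W')|` and `|c₄(W₀)| ≤ |d|²|c₄(W')|` (untwist `W'` by the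
    integral twist model, compare with the minimal `W₀`);
  - `stub_twistTransferSzpiro` (T3, M): T1 → T2 → (WGS for semistable minimal models with exponent `K ≥ 0`,
    constant `C` gives `M⁺(W₀) ≤ C·N^{K+3}` on the twist class), via a global minimal model of the twist
    (`exists_baseChange_int_forall_isMinimalAt`), `conductorNorm_smul`, `isSemistable_smul_iff_holds`, `d⁶ ≤ N³`.
  `d = 1` puts the semistable curves themselves in the twist class.
* `stub_residueSzpiro` (R; NEW; XL; the HONEST OPEN CORE, = old stub C restricted to the complement of
  the twist class): WGS_ss ⟹ WGS for minimal models with NO such `d` (some potentially good `p ≥ 5`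
  of non-quadratic type `e ∈ {3,4,6}`, or additive reduction at 2 or 3 not cured by a `d ≡ 1 (4)` twist).
  By drefute (NegativeNote-stub_semistableToAllSzpiro.md) it contains weak abc for all `16 ∤ abc`
  triples given only WGS_ss; no inert-exponent transfer is known.  Barrier recorded:
  `Literature.Barriers.ABC.HallExponentSharp` (Mordell–Hall curves additive at 2, 3 lie here).
* `stub_quadraticTwistInvariants` (Q; NEW; M; PROVABLE NOW; CALIBRATION stub — not an input of
  `SomeWindowSaving_of`): verbatim the route support `QuadraticTwistInvariants` (stmt-ABC-1977).  With the
  landed `twistAmplificationLemma_proof` (1978) and `someWindowSaving_of_cofiniteWeakGenSzpiro` it gives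
  `SomeWindowSaving_iff_cofiniteWeakGenSzpiro_of` below: the disprover's calibration with NO hypothesis
  left but Q — the kernel-checked statement of exactly how open this crux is (cofinite weak generalized
  Szpiro = weak-abc strength, open since 1985).

`SomeWindowSaving_of hA hR :=
   someWindowSaving_of_weakGenSzpiro (wgsAll_of_transfer_of_residue (T3 T1 T2) hR (bridge hA))`
— by name, no `sorry` outside the `stub_*`; after wave 1 only A and R are hypotheses (T1–T3, Q discharged by
the landed theorems of the same names).

## Disproof used (Cruxes/SomeWindowSaving/Disproof.lean, cdisprove gen-3 v2, 2026-08-16T05:20Z; read in full)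
* §1 calibration `someWindowSaving_iff_cofiniteWeakGenSzpiro (hT : QuadraticTwistInvariants)
  (hA : TwistAmplificationLemma)` — HONOURED and SHARPENED: `hA` is now a theorem (p80304); `hT` is stub Q.
* §2 load-bearing `someWindowSaving_trivial_without_{lowerKappa,upperSigma,threshold}` — the InertBox
  witness keeps all three (`κ = K'+1 ≥ 4`, `σ = κ+1`, `δ = 0 < 1/(2K'−2)`).
* §3/§3' refuted strengthenings (`not_windowSaving_below_third/_law/_law'`, `no_witness_of_sigma_le_six`)
  — consistent: the witness has `κ ≥ 4`, `σ = κ + 1 > 6` … wait, `σ = K'+2 ≥ 5`; for `K' < 4` one has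
  `σ ≤ 6` but then `κ = K'+1 ≥ 9σ/(2σ+3)` holds (`K' ≥ 3`: `κ ≥ 4 ≥ 54/13`), as `no_witness_of_sigma_le_six`
  demands.  Checked below (`example`s).
* §6 Targets: no stub of this line is refutable short of ¬(weak abc) (drefute + cdisprove gen-3).
-/

noncomputable section

open IsDedekindDomain WeierstrassCurve
open Literature.NumberTheory.EllipticCurves
open Literature.NumberTheory.EllipticCurves.ModularForms
open Summit.ABC.ABC.Theses.TwistAmplification
open Summit.ABC.ABC.Theorems.SomeWindowSaving.Negative
open Literature.NumberTheory.DiophantineGeometry (IsABCTriple rad)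

set_option linter.dupNamespace false

namespace Summit.ABC.ABC.Cruxes.SomeWindowSaving.PolynomialDegreeSuffices

/-! ### The statements of the line (named `Prop`s over existing declarations) -/

/-- **Polynomial modular-degree bound, SEMISTABLE curves** (`∃D` form bundling modularity):
VERBATIM the consequent of `IsogenyGlueCongruence.PolyDegreeOfBoundedPrimes` (stmt-ABC-2046). -/
def PolyDegreeSemistable : Prop :=
  ∃ κ C : ℝ, ∀ (W : WeierstrassCurve ℚ) [W.IsElliptic] [W.IsGloballyMinimal]
    [NeZero (W.conductorNorm ℤ)], W.IsSemistable ℤ →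
      ∃ D : ModularParametrizationData W (W.conductorNorm ℤ),
        (D.modularDegree : ℝ) ≤ C * (W.conductorNorm ℤ : ℝ) ^ κ

/-- **Weak generalized Szpiro, SEMISTABLE curves** (`∃K` form, crux vocabulary). -/
def WeakGeneralizedSzpiroSemistable : Prop :=
  ∃ K C : ℝ, ∀ W₀ : WeierstrassCurve ℤ, (W₀.baseChange ℚ).IsElliptic →
    (∀ v : HeightOneSpectrum ℤ, (W₀.baseChange ℚ).IsMinimalAt v) →
      (W₀.baseChange ℚ).IsSemistable ℤ →
        ((max |W₀.Δ| (|W₀.c₄| ^ 3) : ℤ) : ℝ) ≤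
          C * (((W₀.baseChange ℚ).conductorNorm ℤ : ℕ) : ℝ) ^ K

/-- **Weak generalized Szpiro** (`∃K` form of B–G Conj. 12.5.11), crux vocabulary. -/
def WeakGeneralizedSzpiro : Prop :=
  ∃ K C : ℝ, ∀ W₀ : WeierstrassCurve ℤ, (W₀.baseChange ℚ).IsElliptic →
    (∀ v : HeightOneSpectrum ℤ, (W₀.baseChange ℚ).IsMinimalAt v) →
      ((max |W₀.Δ| (|W₀.c₄| ^ 3) : ℤ) : ℝ) ≤
        C * (((W₀.baseChange ℚ).conductorNorm ℤ : ℕ) : ℝ) ^ K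

/-- The TWIST CLASS of a minimal model `W₀/ℤ`: some `d ≡ 1 (mod 4)` with `d² ∣ N` semistabilises it
(its quadratic twist `W₀^{(d)}` is semistable at every prime).  `d = 1` puts every semistable curve in
the class (`exists_variableChange_quadraticTwist_one`, `isSemistable_smul_iff_holds`). -/
def HasSemistableTwist (W₀ : WeierstrassCurve ℤ) : Prop :=
  ∃ d : ℤ, d ≡ 1 [ZMOD 4] ∧ d.natAbs ^ 2 ∣ (W₀.baseChange ℚ).conductorNorm ℤ ∧
    ((W₀.baseChange ℚ).quadraticTwist (d : ℚ)).IsSemistable ℤ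

/-- Statement of STUB T1 (conductor of a semistabilising admissible twist divides the conductor). -/
def TwistConductorDvd : Prop :=
  ∀ (W₀ : WeierstrassCurve ℤ), (W₀.baseChange ℚ).IsElliptic →
    ∀ d : ℤ, d ≡ 1 [ZMOD 4] → d.natAbs ^ 2 ∣ (W₀.baseChange ℚ).conductorNorm ℤ →
      ((W₀.baseChange ℚ).quadraticTwist (d : ℚ)).IsSemistable ℤ →
        ((W₀.baseChange ℚ).quadraticTwist (d : ℚ)).conductorNorm ℤ ∣ (W₀.baseChange ℚ).conductorNorm ℤ

/-- Statement of STUB T2 (size transfer: a minimal model is at most `d⁶` times any integral model of its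
twist by `d ≡ 1 (mod 4)`). -/
def TwistSizeTransfer : Prop :=
  ∀ (W₀ W' : WeierstrassCurve ℤ), (W₀.baseChange ℚ).IsElliptic →
    (∀ v : HeightOneSpectrum ℤ, (W₀.baseChange ℚ).IsMinimalAt v) →
      ∀ (d : ℤ) (C : WeierstrassCurve.VariableChange ℚ), d ≡ 1 [ZMOD 4] →
        C • (W₀.baseChange ℚ).quadraticTwist (d : ℚ) = W'.baseChange ℚ →
          |W₀.Δ| ≤ |d| ^ 6 * |W'.Δ| ∧ |W₀.c₄| ≤ |d| ^ 2 * |W'.c₄|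

/-- Statement of the conclusion of STUB T3 (twist transfer of weak generalized Szpiro along an
admissible twist). -/
def TwistTransferSzpiro : Prop :=
  ∀ K C : ℝ, 0 ≤ K →
    (∀ W₀ : WeierstrassCurve ℤ, (W₀.baseChange ℚ).IsElliptic →
      (∀ v : HeightOneSpectrum ℤ, (W₀.baseChange ℚ).IsMinimalAt v) →
        (W₀.baseChange ℚ).IsSemistable ℤ →
          ((max |W₀.Δ| (|W₀.c₄| ^ 3) : ℤ) : ℝ) ≤
            C * (((W₀.baseChange ℚ).conductorNorm ℤ : ℕ) : ℝ) ^ K) →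
    ∀ W₀ : WeierstrassCurve ℤ, (W₀.baseChange ℚ).IsElliptic →
      (∀ v : HeightOneSpectrum ℤ, (W₀.baseChange ℚ).IsMinimalAt v) →
        ∀ d : ℤ, d ≡ 1 [ZMOD 4] → d.natAbs ^ 2 ∣ (W₀.baseChange ℚ).conductorNorm ℤ →
          ((W₀.baseChange ℚ).quadraticTwist (d : ℚ)).IsSemistable ℤ →
            ((max |W₀.Δ| (|W₀.c₄| ^ 3) : ℤ) : ℝ) ≤
              C * (((W₀.baseChange ℚ).conductorNorm ℤ : ℕ) : ℝ) ^ (K + 3)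

/-- Statement of STUB R (the residue: weak generalized Szpiro outside the twist class). -/
def ResidueSzpiro : Prop :=
  WeakGeneralizedSzpiroSemistable →
    ∃ K C : ℝ, ∀ W₀ : WeierstrassCurve ℤ, (W₀.baseChange ℚ).IsElliptic →
      (∀ v : HeightOneSpectrum ℤ, (W₀.baseChange ℚ).IsMinimalAt v) →
        (¬ ∃ d : ℤ, d ≡ 1 [ZMOD 4] ∧ d.natAbs ^ 2 ∣ (W₀.baseChange ℚ).conductorNorm ℤ ∧
            ((W₀.baseChange ℚ).quadraticTwist (d : ℚ)).IsSemistable ℤ) →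
          ((max |W₀.Δ| (|W₀.c₄| ^ 3) : ℤ) : ℝ) ≤
            C * (((W₀.baseChange ℚ).conductorNorm ℤ : ℕ) : ℝ) ^ K

/-- **Cofinite weak generalized Szpiro** (the disprover's `CofiniteWeakGenSzpiro`, verbatim): the
pointwise content of the crux. -/
def CofiniteWeakGenSzpiro : Prop :=
  ∃ K N₀ : ℝ, ∀ W₀ : WeierstrassCurve ℤ, (W₀.baseChange ℚ).IsElliptic →
    (∀ v : HeightOneSpectrum ℤ, (W₀.baseChange ℚ).IsMinimalAt v) → W₀.c₄ ≠ 0 → W₀.c₆ ≠ 0 →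
      N₀ ≤ (((W₀.baseChange ℚ).conductorNorm ℤ : ℕ) : ℝ) →
        ((max |W₀.Δ| (|W₀.c₄| ^ 3) : ℤ) : ℝ) ≤ (((W₀.baseChange ℚ).conductorNorm ℤ : ℕ) : ℝ) ^ K

/-! ### The registered stubs (statements expanded over existing declarations) -/

/-- STUB A (XL, OPEN, SUPPLIED ELSEWHERE; unchanged) — `PolyDegreeSemistable`, verbatim the polynomial
waypoint of route `IsogenyGlueCongruence` (consequent of `PolyDegreeOfBoundedPrimes` stmt-ABC-2046 given
`DegreePrimesPolyBounded` stmt-ABC-2045).  Verdict on file (lead-0 worker): `stub-blocked: stmt-ABC-2046`.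
Contains weak abc for `16 ∣ abc` triples; only `log deg φ ≪ N log N` is proved (PastenShimura2024 Thm 1.9). -/
theorem stub_polyDegreeSemistable :
    ∃ κ C : ℝ, ∀ (W : WeierstrassCurve ℚ) [W.IsElliptic] [W.IsGloballyMinimal]
      [NeZero (W.conductorNorm ℤ)], W.IsSemistable ℤ →
        ∃ D : ModularParametrizationData W (W.conductorNorm ℤ),
          (D.modularDegree : ℝ) ≤ C * (W.conductorNorm ℤ : ℝ) ^ κ := by
  sorry

/-- STUB T1 (M, PROVABLE NOW — fanned out) — `TwistConductorDvd`: for an elliptic `E = W₀ ⊗ ℚ`,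
`d ≡ 1 (mod 4)` with `d² ∣ N(E)` and `E^{(d)} := E.quadraticTwist d` semistable, `N(E^{(d)}) ∣ N(E)`.
PLAN: `d = 4k+1`; `E^{(d)} = C₁ • E.twistModel k` (`exists_variableChange_twistModel_eq_quadraticTwist`), so
`f_p(E^{(d)}) = f_p(E.twistModel k)` (`conductorExponent_smul'`); at `p ∤ d` this is `f_p(E)`
(`conductorExponent_twistModel`, `|k|_p ≤ 1`, `|4k+1|_p = 1`); at `p ∣ d`, semistability gives `f_p ≤ 1`
(`IsSemistableAt` = good ∨ multiplicative; `conductorExponent_eq_zero_iff_holds`, `conductorExponent_eq_one_iff_holds`)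
while `2 ≤ 2 v_p(d) ≤ v_p(N(E))`; conclude with `factorization_conductorNorm_primesEquiv_symm` on both sides
and `Nat.factorization_le_iff_dvd` (or `conductorNorm_dvd_of_forall_conductorExponent_le`). -/
theorem stub_twistConductorDvd :
    ∀ (W₀ : WeierstrassCurve ℤ), (W₀.baseChange ℚ).IsElliptic →
      ∀ d : ℤ, d ≡ 1 [ZMOD 4] → d.natAbs ^ 2 ∣ (W₀.baseChange ℚ).conductorNorm ℤ →
        ((W₀.baseChange ℚ).quadraticTwist (d : ℚ)).IsSemistable ℤ →
          ((W₀.baseChange ℚ).quadraticTwist (d : ℚ)).conductorNorm ℤ ∣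
            (W₀.baseChange ℚ).conductorNorm ℤ :=
  -- CLOSED: landed (see header); the registered stub discharged by the tree theorem of the same name.
  Summit.ABC.ABC.Theorems.stub_twistConductorDvd

/-- STUB T2 (M/L, PROVABLE NOW — fanned out) — `TwistSizeTransfer`: if `W₀/ℤ` is minimal at every prime
and `W'/ℤ` is ANY integral model of the twist (`C • (W₀ ⊗ ℚ).quadraticTwist d = W' ⊗ ℚ`, `d ≡ 1 (mod 4)`),
then `|Δ(W₀)| ≤ |d|⁶ |Δ(W')|` and `|c₄(W₀)| ≤ |d|² |c₄(W')|`.  PLAN: `d = 4k+1`, `E := W₀ ⊗ ℚ`;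
`W'' := W'.twistModel k` is integral with `Δ'' = d⁶Δ'`, `c₄'' = d²c₄'` (`twistModel_Δ/_c₄`), and
`W'' ⊗ ℚ = (W' ⊗ ℚ).twistModel k` (`map_twistModel`) `= twistMap k (C C₁) • E.twistModel (4k²+2k)`
(`E.quadraticTwist d = C₁ • E.twistModel k`, `twistModel_smul`, `twistModel_twistModel`), while
`E.twistModel (4k²+2k) ≅ E.quadraticTwist (d²) ≅ E.quadraticTwist 1 ≅ E`
(`exists_variableChange_twistModel_eq_quadraticTwist`, `exists_variableChange_quadraticTwist_mul_sq`,
`exists_variableChange_quadraticTwist_one`); so `W₀ ⊗ ℚ = C₃ • (W'' ⊗ ℚ)`.  At each prime, minimality of `W₀`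
(Mathlib `IsMinimal.val_Δ_maximal`, pattern `valuation_Δ_smul_eq_of_isMinimal` in LocalReductionProofs) gives
`v_p(Δ(W₀)) ≤ v_p(Δ'')`, hence `|Δ(W₀)| ≤ |Δ''| = |d|⁶|Δ'|`; and `u := C₃.u` has `Δ(W₀) = u⁻¹²Δ''`,
so `|u| ≥ 1` and `|c₄(W₀)| = |u|⁻⁴|c₄''| ≤ |d|²|c₄'|` (`variableChange_Δ`, `variableChange_c₄`). -/
theorem stub_twistSizeTransfer :
    ∀ (W₀ W' : WeierstrassCurve ℤ), (W₀.baseChange ℚ).IsElliptic →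
      (∀ v : HeightOneSpectrum ℤ, (W₀.baseChange ℚ).IsMinimalAt v) →
        ∀ (d : ℤ) (C : WeierstrassCurve.VariableChange ℚ), d ≡ 1 [ZMOD 4] →
          C • (W₀.baseChange ℚ).quadraticTwist (d : ℚ) = W'.baseChange ℚ →
            |W₀.Δ| ≤ |d| ^ 6 * |W'.Δ| ∧ |W₀.c₄| ≤ |d| ^ 2 * |W'.c₄| :=
  -- CLOSED: landed (see header); the registered stub discharged by the tree theorem of the same name.
  Summit.ABC.ABC.Theorems.stub_twistSizeTransfer

/-- STUB T3 (M, PROVABLE NOW — fanned out) — `TwistConductorDvd → TwistSizeTransfer → TwistTransferSzpiro`: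
weak generalized Szpiro for semistable minimal models (exponent `K ≥ 0`, constant `C`) transfers to every
minimal `W₀` admitting `d ≡ 1 (mod 4)`, `d² ∣ N(W₀)`, with semistable `W₀^{(d)}`, at the cost `K ↦ K+3`.
PLAN: `E := W₀ ⊗ ℚ`, `E' := E.quadraticTwist d` (elliptic: `isElliptic_quadraticTwist`, `d ≠ 0` as `d` is odd);
`exists_baseChange_int_forall_isMinimalAt E'` gives `C' • E' = W' ⊗ ℚ` with `W'` minimal at all `v`; `W' ⊗ ℚ` is
elliptic and semistable (`isSemistable_smul_iff_holds`), so the hypothesis gives `M⁺(W') ≤ C·N'^K` with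
`N' = N(W' ⊗ ℚ) = N(E')` (`conductorNorm_smul`) `≤ N := N(E)` (T1, `conductorNorm_pos_holds`); T2 gives
`M⁺(W₀) ≤ |d|⁶ M⁺(W')`; `d.natAbs² ∣ N` gives `|d|⁶ ≤ N³`; `K ≥ 0` gives `N'^K ≤ N^K`; `0 < M⁺(W') ≤ C N'^K`
gives `C > 0`; so `M⁺(W₀) ≤ N³·C·N^K = C·N^{K+3}` (`Real.rpow_add`, `Real.rpow_natCast`). -/
theorem stub_twistTransferSzpiro :
    (∀ (W₀ : WeierstrassCurve ℤ), (W₀.baseChange ℚ).IsElliptic →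
      ∀ d : ℤ, d ≡ 1 [ZMOD 4] → d.natAbs ^ 2 ∣ (W₀.baseChange ℚ).conductorNorm ℤ →
        ((W₀.baseChange ℚ).quadraticTwist (d : ℚ)).IsSemistable ℤ →
          ((W₀.baseChange ℚ).quadraticTwist (d : ℚ)).conductorNorm ℤ ∣
            (W₀.baseChange ℚ).conductorNorm ℤ) →
    (∀ (W₀ W' : WeierstrassCurve ℤ), (W₀.baseChange ℚ).IsElliptic →
      (∀ v : HeightOneSpectrum ℤ, (W₀.baseChange ℚ).IsMinimalAt v) →
        ∀ (d : ℤ) (C : WeierstrassCurve.VariableChange ℚ), d ≡ 1 [ZMOD 4] →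
          C • (W₀.baseChange ℚ).quadraticTwist (d : ℚ) = W'.baseChange ℚ →
            |W₀.Δ| ≤ |d| ^ 6 * |W'.Δ| ∧ |W₀.c₄| ≤ |d| ^ 2 * |W'.c₄|) →
    ∀ K C : ℝ, 0 ≤ K →
      (∀ W₀ : WeierstrassCurve ℤ, (W₀.baseChange ℚ).IsElliptic →
        (∀ v : HeightOneSpectrum ℤ, (W₀.baseChange ℚ).IsMinimalAt v) →
          (W₀.baseChange ℚ).IsSemistable ℤ →
            ((max |W₀.Δ| (|W₀.c₄| ^ 3) : ℤ) : ℝ) ≤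
              C * (((W₀.baseChange ℚ).conductorNorm ℤ : ℕ) : ℝ) ^ K) →
      ∀ W₀ : WeierstrassCurve ℤ, (W₀.baseChange ℚ).IsElliptic →
        (∀ v : HeightOneSpectrum ℤ, (W₀.baseChange ℚ).IsMinimalAt v) →
          ∀ d : ℤ, d ≡ 1 [ZMOD 4] → d.natAbs ^ 2 ∣ (W₀.baseChange ℚ).conductorNorm ℤ →
            ((W₀.baseChange ℚ).quadraticTwist (d : ℚ)).IsSemistable ℤ →
              ((max |W₀.Δ| (|W₀.c₄| ^ 3) : ℤ) : ℝ) ≤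
                C * (((W₀.baseChange ℚ).conductorNorm ℤ : ℕ) : ℝ) ^ (K + 3) :=
  -- CLOSED: landed (see header); the registered stub discharged by the tree theorem of the same name.
  Summit.ABC.ABC.Theorems.stub_twistTransferSzpiro

/-- STUB R (XL, OPEN, HARDEST — the honest open core; the lead's stub) — `ResidueSzpiro`: weak
generalized Szpiro for semistable curves gives weak generalized Szpiro for the minimal models OUTSIDE the
twist class (no `d ≡ 1 (mod 4)`, `d² ∣ N`, with semistable `W₀^{(d)}`).  These are the curves with a
potentially good prime `p ≥ 5` of Kodaira type II, III, IV, IV*, III*, II* (`e ∈ {6,4,3}`), or additive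
at 2 or 3 beyond the reach of an unramified-at-2 twist.  DREFUTE (2026-08-16, residue analysis made
rigorous): the Frey curve of an abc triple has a quadratic twist semistable at 2 iff `16 ∣ abc`, so this
stub ⊇ weak abc `c ≤ C·rad(abc)^{K'}` for ALL `16 ∤ abc` triples given only WGS_ss — an inert-exponent
transfer nobody knows (power-map devices need abc-exponent `< n/(n−1)`; provable regime `6 < K < 144/23`
while WGS_ss forces `K > 6`, `Negative.WeakSzpiroTightSix`).  Implied by ABC (B–G 12.5.12 ⟹ generalized
Szpiro ⟹ WGS, `someWindowSaving_of_abc`'s chain); no supplier on the summit.  Barrier: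
`Literature.Barriers.ABC.HallExponentSharp` bites the Mordell–Hall members (recorded, not evaded). -/
theorem stub_residueSzpiro :
    (∃ K C : ℝ, ∀ W₀ : WeierstrassCurve ℤ, (W₀.baseChange ℚ).IsElliptic →
      (∀ v : HeightOneSpectrum ℤ, (W₀.baseChange ℚ).IsMinimalAt v) →
        (W₀.baseChange ℚ).IsSemistable ℤ →
          ((max |W₀.Δ| (|W₀.c₄| ^ 3) : ℤ) : ℝ) ≤
            C * (((W₀.baseChange ℚ).conductorNorm ℤ : ℕ) : ℝ) ^ K) →
    ∃ K C : ℝ, ∀ W₀ : WeierstrassCurve ℤ, (W₀.baseChange ℚ).IsElliptic →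
      (∀ v : HeightOneSpectrum ℤ, (W₀.baseChange ℚ).IsMinimalAt v) →
        (¬ ∃ d : ℤ, d ≡ 1 [ZMOD 4] ∧ d.natAbs ^ 2 ∣ (W₀.baseChange ℚ).conductorNorm ℤ ∧
            ((W₀.baseChange ℚ).quadraticTwist (d : ℚ)).IsSemistable ℤ) →
          ((max |W₀.Δ| (|W₀.c₄| ^ 3) : ℤ) : ℝ) ≤
            C * (((W₀.baseChange ℚ).conductorNorm ℤ : ℕ) : ℝ) ^ K := by
  sorry

/-- STUB Q (M, PROVABLE NOW — fanned out; CALIBRATION stub, = route support stmt-ABC-1977 verbatim) —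
`QuadraticTwistInvariants`: Tate's algorithm for an unramified prime-to-`6N` twist of a global minimal
model.  PROOF PLAN: `d = 4k+1`; `W₁ := W₀.twistModel k`; `W₁.Δ = d⁶ W₀.Δ`, `W₁.c₄ = d² W₀.c₄`
(`twistModel_Δ/_c₄`); `W₁ ⊗ ℚ = (W₀ ⊗ ℚ).twistModel k = C⁻¹ • (W₀ ⊗ ℚ).quadraticTwist d`
(`map_twistModel`, `exists_variableChange_twistModel_eq_quadraticTwist`); minimal at `p ∤ d` by
`isMinimalAt_twistModel`, at `p ∣ d` (`p ≥ 5`, `p ∤ N` so `p ∤ Δ(W₀)` by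
`conductorExponent_ne_zero_of_dvd_Δ`/`factorization_conductorNorm_holds`, hence `v_p(Δ₁) = 6 < 12`) by
`isMinimalAt_baseChange_int_of_not_pow_dvd_Δ`; conductor prime by prime through
`factorization_conductorNorm_primesEquiv_symm`: `f_p(W₁) = f_p(W₀)` at `p ∤ d`
(`conductorExponent_twistModel`), `f_p(W₁) = 2` at `p ∣ d` (`two_le_conductorExponent_of_dvd_Δ_of_dvd_c₄`,
`conductorExponent_le_two_of_five_le_natGenerator_holds`), `= v_p(N) + 2 v_p(d)`; `Nat.eq_of_factorization_eq`. -/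
theorem stub_quadraticTwistInvariants :
    ∀ (W₀ : WeierstrassCurve ℤ), (W₀.baseChange ℚ).IsElliptic →
      (∀ v : IsDedekindDomain.HeightOneSpectrum ℤ, (W₀.baseChange ℚ).IsMinimalAt v) →
        ∀ d : ℤ, Squarefree d → d ≡ 1 [ZMOD 4] →
          IsCoprime d (6 * ((W₀.baseChange ℚ).conductorNorm ℤ : ℤ)) →
            ∃ (W₁ : WeierstrassCurve ℤ) (e : WeierstrassCurve.VariableChange ℚ),
              W₁.baseChange ℚ = e • (W₀.baseChange ℚ).quadraticTwist (d : ℚ) ∧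
              (∀ v : IsDedekindDomain.HeightOneSpectrum ℤ, (W₁.baseChange ℚ).IsMinimalAt v) ∧
              W₁.Δ = d ^ 6 * W₀.Δ ∧ W₁.c₄ = d ^ 2 * W₀.c₄ ∧
              (W₁.baseChange ℚ).conductorNorm ℤ =
                (W₀.baseChange ℚ).conductorNorm ℤ * d.natAbs ^ 2 :=
  -- CLOSED: landed (see header); the registered stub discharged by the tree theorem of the same name.
  Summit.ABC.ABC.Theorems.stub_quadraticTwistInvariants

/-! ### Consistency: each named statement IS its registered stub (definitionally) -/

theorem polyDegreeSemistable_holds : PolyDegreeSemistable := stub_polyDegreeSemistable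
theorem twistConductorDvd_holds : TwistConductorDvd := stub_twistConductorDvd
theorem twistSizeTransfer_holds : TwistSizeTransfer := stub_twistSizeTransfer
theorem twistTransferSzpiro_holds : TwistConductorDvd → TwistSizeTransfer → TwistTransferSzpiro :=
  stub_twistTransferSzpiro
theorem residueSzpiro_holds : ResidueSzpiro := stub_residueSzpiro
theorem quadraticTwistInvariants_holds : QuadraticTwistInvariants := stub_quadraticTwistInvariants

/-! ### Name-keyed aliases of the stub statements (hypotheses of the compositions) -/
namespace Registered

/-- Alias of `PolyDegreeSemistable` keyed by the registered stub name. -/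
abbrev stub_polyDegreeSemistable : Prop := PolyDegreeSemistable
/-- Alias of `TwistConductorDvd` keyed by the registered stub name. -/
abbrev stub_twistConductorDvd : Prop := TwistConductorDvd
/-- Alias of `TwistSizeTransfer` keyed by the registered stub name. -/
abbrev stub_twistSizeTransfer : Prop := TwistSizeTransfer
/-- Alias of the T3 implication keyed by the registered stub name. -/
abbrev stub_twistTransferSzpiro : Prop := TwistConductorDvd → TwistSizeTransfer → TwistTransferSzpiro
/-- Alias of `ResidueSzpiro` keyed by the registered stub name. -/
abbrev stub_residueSzpiro : Prop := ResidueSzpiro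
/-- Alias of `QuadraticTwistInvariants` keyed by the registered stub name. -/
abbrev stub_quadraticTwistInvariants : Prop := QuadraticTwistInvariants

end Registered

/-! ### Glue (PROVED): twist class ∪ residue = everything -/

/-- Real bookkeeping: `x ≤ C·n^K` with `1 ≤ n`, `C ≤ C'`, `0 ≤ C'`, `K ≤ K'` gives `x ≤ C'·n^{K'}`. -/
theorem le_mul_rpow_mono {x C C' n K K' : ℝ} (hn : 1 ≤ n) (hC : C ≤ C') (hC' : 0 ≤ C') (hK : K ≤ K')
    (h : x ≤ C * n ^ K) : x ≤ C' * n ^ K' :=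
  calc x ≤ C * n ^ K := h
    _ ≤ C' * n ^ K := mul_le_mul_of_nonneg_right hC (Real.rpow_nonneg (zero_le_one.trans hn) K)
    _ ≤ C' * n ^ K' := mul_le_mul_of_nonneg_left (Real.rpow_le_rpow_of_exponent_le hn hK) hC'

/-- **WGS_ss ∧ T ∧ R ⟹ WGS_all.**  Normalise the semistable witness to `K₀ := max K 0 ≥ 0`,
`C₀ := max C 0`; the transfer stub covers the twist class with `(K₀+3, C₀)`, the residue stub covers the
complement with some `(K₂, C₂)`; take `K* := max (K₀+3) (max K₂ 0)`, `C* := max C₀ (max C₂ 0)`. -/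
theorem wgsAll_of_transfer_of_residue (hT : TwistTransferSzpiro) (hR : ResidueSzpiro)
    (hss : WeakGeneralizedSzpiroSemistable) : WeakGeneralizedSzpiro := by
  obtain ⟨K₂, C₂, h₂⟩ := hR hss
  obtain ⟨K, C, h⟩ := hss
  set K₀ : ℝ := max K 0 with hK₀
  set C₀ : ℝ := max C 0 with hC₀
  have hK₀0 : 0 ≤ K₀ := le_max_right _ _
  have hC₀0 : 0 ≤ C₀ := le_max_right _ _
  -- the semistable bound with the normalised exponent/constant
  have h₀ : ∀ W₀ : WeierstrassCurve ℤ, (W₀.baseChange ℚ).IsElliptic →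
      (∀ v : HeightOneSpectrum ℤ, (W₀.baseChange ℚ).IsMinimalAt v) →
        (W₀.baseChange ℚ).IsSemistable ℤ →
          ((max |W₀.Δ| (|W₀.c₄| ^ 3) : ℤ) : ℝ) ≤
            C₀ * (((W₀.baseChange ℚ).conductorNorm ℤ : ℕ) : ℝ) ^ K₀ := by
    intro W₀ hE hmin hss'
    haveI := hE
    have hn : (1 : ℝ) ≤ (((W₀.baseChange ℚ).conductorNorm ℤ : ℕ) : ℝ) := by
      exact_mod_cast conductorNorm_pos_holds (W₀.baseChange ℚ)
    exact le_mul_rpow_mono hn (le_max_left _ _) hC₀0 (le_max_left _ _) (h W₀ hE hmin hss')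
  have hT' := hT K₀ C₀ hK₀0 h₀
  refine ⟨max (K₀ + 3) (max K₂ 0), max C₀ (max C₂ 0), fun W₀ hE hmin ↦ ?_⟩
  haveI := hE
  have hn : (1 : ℝ) ≤ (((W₀.baseChange ℚ).conductorNorm ℤ : ℕ) : ℝ) := by
    exact_mod_cast conductorNorm_pos_holds (W₀.baseChange ℚ)
  have hCstar : 0 ≤ max C₀ (max C₂ 0) := hC₀0.trans (le_max_left _ _)
  by_cases htw : ∃ d : ℤ, d ≡ 1 [ZMOD 4] ∧ d.natAbs ^ 2 ∣ (W₀.baseChange ℚ).conductorNorm ℤ ∧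
      ((W₀.baseChange ℚ).quadraticTwist (d : ℚ)).IsSemistable ℤ
  · obtain ⟨d, hd4, hdN, hdss⟩ := htw
    exact le_mul_rpow_mono hn (le_max_left _ _) hCstar (le_max_left _ _)
      (hT' W₀ hE hmin d hd4 hdN hdss)
  · exact le_mul_rpow_mono hn ((le_max_left _ _).trans (le_max_right _ _)) hCstar
      ((le_max_left _ _).trans (le_max_right _ _)) (h₂ W₀ hE hmin htw)

/-! ### The composition: the stubs imply the crux, by name -/

/-- `SomeWindowSaving` from the stubs (pure logic; no `sorry`): STUB A fed into the LANDED bridge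
(`Summit.ABC.ABC.Theorems.stub_zagierSilvermanBridgeSemistable`) gives WGS for semistable curves; STUBS
T1–T3 (twist transfer) and STUB R (residue) upgrade it to all curves (`wgsAll_of_transfer_of_residue`); the
LANDED inert box (`Summit.ABC.ABC.Theorems.someWindowSaving_of_weakGenSzpiro`) turns WGS into the crux. -/
theorem SomeWindowSaving_of (hA : Registered.stub_polyDegreeSemistable)
    (hR : Registered.stub_residueSzpiro) :
    Summit.ABC.ABC.Theses.TwistAmplification.SomeWindowSaving :=
  -- T1, T2, T3 are CLOSED (landed p85937, p85638, p85633) and discharged here by name;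
  -- only the OPEN stubs A and R remain hypotheses.
  Summit.ABC.ABC.Theorems.someWindowSaving_of_weakGenSzpiro
    (wgsAll_of_transfer_of_residue
      (stub_twistTransferSzpiro stub_twistConductorDvd stub_twistSizeTransfer) hR
      (Summit.ABC.ABC.Theorems.stub_zagierSilvermanBridgeSemistable hA))

/-- Wiring check: the registered stubs feed `SomeWindowSaving_of` as stated. -/
example : Summit.ABC.ABC.Theses.TwistAmplification.SomeWindowSaving :=
  SomeWindowSaving_of stub_polyDegreeSemistable stub_residueSzpiro

/-! ### Calibration (PROVED; STUB Q landed p87180; the unconditional iff is LANDED as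
`Summit.ABC.ABC.Theorems.someWindowSaving_iff_cofiniteWeakGenSzpiro`, Theorems/TwistAmplificationSomeWindowSavingCalibration.lean,
p89341, together with `polynomialABC_of_someWindowSaving : SomeWindowSaving → PolynomialABC` (stmt-ABC-1724 verbatim)) -/

/-- (⟹) The crux gives cofinite weak generalized Szpiro, through STUB Q (= stmt-ABC-1977) and the LANDED
`twistAmplificationLemma_proof` (stmt-ABC-1978): one amplification at `σ' := σ + 1`. -/
theorem cofiniteWeakGenSzpiro_of_someWindowSaving (hQ : Registered.stub_quadraticTwistInvariants)
    (h : SomeWindowSaving) : CofiniteWeakGenSzpiro := by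
  obtain ⟨κ, σ, δ, C, hκ, hκσ, hδ, hcount⟩ := h
  obtain ⟨N₀, hN₀⟩ := Summit.ABC.ABC.Theorems.twistAmplificationLemma_proof hQ κ σ δ C hκ hκσ hδ hcount
    (σ + 1) (by linarith)
  exact ⟨σ + 1, N₀, fun W₀ hE hmin hc₄ hc₆ hN ↦ hN₀ W₀ hE hmin hc₄ hc₆ hN⟩

/-- **CALIBRATION modulo STUB Q only.** `SomeWindowSaving ↔ CofiniteWeakGenSzpiro`: ⟹ by the previous
theorem, ⟸ unconditionally by the LANDED `someWindowSaving_of_cofiniteWeakGenSzpiro`.  Once STUB Q lands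
this is an unconditional Theorems file: the crux is EXACTLY cofinite weak generalized Szpiro for non-CM-j
minimal models (weak-abc strength; Oesterlé 1988 Conj. 1 forme faible; B–G §12.5). -/
theorem SomeWindowSaving_iff_cofiniteWeakGenSzpiro_of (hQ : Registered.stub_quadraticTwistInvariants) :
    SomeWindowSaving ↔ CofiniteWeakGenSzpiro :=
  ⟨cofiniteWeakGenSzpiro_of_someWindowSaving hQ,
    Summit.ABC.ABC.Theorems.someWindowSaving_of_cofiniteWeakGenSzpiro⟩

/-- Wiring check for the calibration. -/
example : SomeWindowSaving ↔ CofiniteWeakGenSzpiro :=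
  SomeWindowSaving_iff_cofiniteWeakGenSzpiro_of stub_quadraticTwistInvariants

/-! ### Calibration (PROVED): what the open stubs contain -/

/-- Real-arithmetic core: from `c² ≤ 2 x`, `x³ ≤ M`, `M ≤ C N^K`, `N ≤ 2¹⁰ R`, with `C ≥ 1`, `K ≥ 0`,
`N, R ≥ 1`, `c ≥ 0`: `c ≤ (8 C 2^{10K})^{1/6} · R^{K/6}`. -/
theorem abc_bound_aux {c x M C N K R : ℝ} (hc : 0 ≤ c) (hC : 1 ≤ C) (hK : 0 ≤ K) (hN : 1 ≤ N)
    (hR : 1 ≤ R) (hcx : c ^ 2 ≤ 2 * x) (hxM : x ^ 3 ≤ M) (hM : M ≤ C * N ^ K) (hNR : N ≤ 2 ^ 10 * R) :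
    c ≤ (8 * C * (2 ^ 10) ^ K) ^ (1 / 6 : ℝ) * R ^ (K / 6) := by
  have hR0 : 0 < R := by linarith
  have hN0 : 0 < N := by linarith
  have hx : c ^ 2 / 2 ≤ x := by linarith
  have hc6 : c ^ 6 ≤ 8 * M := by
    have h1 : (c ^ 2 / 2) ^ 3 ≤ x ^ 3 := by
      exact pow_le_pow_left₀ (by positivity) hx 3
    nlinarith [h1, hxM]
  have hNK : N ^ K ≤ (2 ^ 10 * R) ^ K := Real.rpow_le_rpow hN0.le hNR hK
  have hsplit : (2 ^ 10 * R : ℝ) ^ K = (2 ^ 10) ^ K * R ^ K :=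
    Real.mul_rpow (by norm_num) hR0.le
  have hc6' : c ^ 6 ≤ (8 * C * (2 ^ 10) ^ K) * R ^ K := by
    calc c ^ 6 ≤ 8 * M := hc6
      _ ≤ 8 * (C * N ^ K) := by linarith
      _ ≤ 8 * (C * ((2 ^ 10) ^ K * R ^ K)) := by
          rw [← hsplit]
          exact mul_le_mul_of_nonneg_left (mul_le_mul_of_nonneg_left hNK (by linarith)) (by norm_num)
      _ = (8 * C * (2 ^ 10) ^ K) * R ^ K := by ring
  have hA0 : 0 ≤ 8 * C * (2 ^ 10 : ℝ) ^ K := by positivity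
  have hc6eq : (c ^ 6) ^ (1 / 6 : ℝ) = c := by
    rw [show c ^ 6 = c ^ ((6 : ℕ) : ℝ) by rw [Real.rpow_natCast], ← Real.rpow_mul hc]
    norm_num
  calc c = (c ^ 6) ^ (1 / 6 : ℝ) := hc6eq.symm
    _ ≤ ((8 * C * (2 ^ 10) ^ K) * R ^ K) ^ (1 / 6 : ℝ) :=
        Real.rpow_le_rpow (by positivity) hc6' (by norm_num)
    _ = (8 * C * (2 ^ 10) ^ K) ^ (1 / 6 : ℝ) * (R ^ K) ^ (1 / 6 : ℝ) :=
        Real.mul_rpow hA0 (Real.rpow_nonneg hR0.le K)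
    _ = (8 * C * (2 ^ 10) ^ K) ^ (1 / 6 : ℝ) * R ^ (K / 6) := by
        rw [← Real.rpow_mul hR0.le]; ring_nf

/-- **Weak generalized Szpiro ⟹ weak abc** `c ≤ C · rad(abc)^K` (open since Masser–Oesterlé 1985),
through the tree's minimal Frey models (`exists_minimal_frey_model`: `N ∣ 2¹⁰ rad(abc)`, `c² ≤ 2|c₄|`):
`c⁶ ≤ 8|c₄|³ ≤ 8 M⁺ ≤ 8 C N^K ≤ 8 C 2^{10K} rad^K`.  (Lead-0; kept as the calibration of what T ∧ R output.) -/
theorem weakAbc_of_weakGeneralizedSzpiro (h : WeakGeneralizedSzpiro) :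
    ∃ K C : ℝ, ∀ a b c : ℕ, IsABCTriple a b c → (c : ℝ) ≤ C * ((rad a b c : ℕ) : ℝ) ^ K := by
  obtain ⟨K, C, h⟩ := h
  set K' : ℝ := max K 0 with hK'
  set C' : ℝ := max C 1 with hC'
  refine ⟨K' / 6, (8 * C' * (2 ^ 10) ^ K') ^ (1 / 6 : ℝ), fun a b c ht ↦ ?_⟩
  obtain ⟨W₀, hE, hmin, hdvd, hc₄⟩ := exists_minimal_frey_model ht
  have hradpos : 0 < rad a b c := by
    obtain ⟨ha, hb, habc, -⟩ := ht
    rw [Literature.NumberTheory.DiophantineGeometry.rad_def]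
    exact Nat.pos_of_ne_zero UniqueFactorizationMonoid.radical_ne_zero
  have hNpos : 0 < (W₀.baseChange ℚ).conductorNorm ℤ := conductorNorm_pos_holds (W₀.baseChange ℚ)
  have hNle : (W₀.baseChange ℚ).conductorNorm ℤ ≤ 2 ^ 10 * rad a b c :=
    Nat.le_of_dvd (by positivity) hdvd
  have hN1 : (1 : ℝ) ≤ (((W₀.baseChange ℚ).conductorNorm ℤ : ℕ) : ℝ) := by exact_mod_cast hNpos
  have hR1 : (1 : ℝ) ≤ ((rad a b c : ℕ) : ℝ) := by exact_mod_cast hradpos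
  have hNR : (((W₀.baseChange ℚ).conductorNorm ℤ : ℕ) : ℝ) ≤ 2 ^ 10 * ((rad a b c : ℕ) : ℝ) := by
    exact_mod_cast hNle
  have hM := h W₀ hE hmin
  have hM' : ((max |W₀.Δ| (|W₀.c₄| ^ 3) : ℤ) : ℝ) ≤
      C' * (((W₀.baseChange ℚ).conductorNorm ℤ : ℕ) : ℝ) ^ K' :=
    le_mul_rpow_mono hN1 (le_max_left _ _) (zero_le_one.trans (le_max_right _ _)) (le_max_left _ _) hM
  have hxM : (|(W₀.c₄ : ℝ)|) ^ 3 ≤ ((max |W₀.Δ| (|W₀.c₄| ^ 3) : ℤ) : ℝ) := by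
    push_cast
    exact le_max_right _ _
  have hcx : ((c : ℕ) : ℝ) ^ 2 ≤ 2 * |(W₀.c₄ : ℝ)| := by
    have : (((c : ℕ) : ℤ) : ℝ) ^ 2 ≤ 2 * |((W₀.c₄ : ℤ) : ℝ)| := by exact_mod_cast hc₄
    simpa using this
  exact abc_bound_aux (Nat.cast_nonneg c) (le_max_right _ _) (le_max_right _ _) hN1 hR1 hcx hxM hM' hNR

/-- What closing T ∧ R (given A and the landed bridge) delivers beyond the crux: weak abc for ALL triples. -/
example (hA : PolyDegreeSemistable) (hT : TwistTransferSzpiro) (hR : ResidueSzpiro) :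
    ∃ K C : ℝ, ∀ a b c : ℕ, IsABCTriple a b c → (c : ℝ) ≤ C * ((rad a b c : ℕ) : ℝ) ^ K :=
  weakAbc_of_weakGeneralizedSzpiro
    (wgsAll_of_transfer_of_residue hT hR (Summit.ABC.ABC.Theorems.stub_zagierSilvermanBridgeSemistable hA))

/-- Sanity: `d = 1` is admissible for every semistable curve, so the twist class contains the semistable
curves (the residue stub never sees them). -/
example (W₀ : WeierstrassCurve ℤ) [hE : (W₀.baseChange ℚ).IsElliptic]
    (hss : (W₀.baseChange ℚ).IsSemistable ℤ) :
    ∃ d : ℤ, d ≡ 1 [ZMOD 4] ∧ d.natAbs ^ 2 ∣ (W₀.baseChange ℚ).conductorNorm ℤ ∧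
      ((W₀.baseChange ℚ).quadraticTwist (d : ℚ)).IsSemistable ℤ := by
  obtain ⟨C, hC⟩ := exists_variableChange_quadraticTwist_one (W₀.baseChange ℚ)
  refine ⟨1, Int.ModEq.refl 1, by simp, ?_⟩
  rw [Int.cast_one, ← hC]
  exact (isSemistable_smul_iff_holds ℤ (W₀.baseChange ℚ) C).mpr hss

/-! ### Scratch checks against the landed `Negative/*` lemmas (Disproof §2–§3') -/

/-- The refuted strengthening `not_windowSaving_below_law` (landed): no saving below `1 − κ/6` for
`3 < κ < 4` — the InertBox witness has `κ = max K 3 + 1 ≥ 4`, outside its range. -/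
example : ¬ ∃ κ σ δ C : ℝ, 3 < κ ∧ κ < 4 ∧ 12 < σ ∧ δ < 1 - κ / 6 ∧
    ∀ X : ℝ, 1 ≤ X → (windowCount κ σ X : ℝ) ≤ C * X ^ δ :=
  not_windowSaving_below_law

/-- `no_witness_of_sigma_le_six` (landed, gen-3): a witness with `σ ≤ 6` needs `κ(2σ+3) ≥ 9σ`; the
InertBox witness `(κ, σ) = (K'+1, K'+2)`, `K' ≥ 3`, satisfies it (`(K'+1)(2K'+7) ≥ 9(K'+2)` for `K' ≥ 3`). -/
example : ¬ ∃ κ σ δ C : ℝ, 3 < κ ∧ κ < σ ∧ σ ≤ 6 ∧ κ * (2 * σ + 3) < 9 * σ ∧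
    δ < (σ - κ) / (2 * σ - 6) ∧
    ∀ X : ℝ, 1 ≤ X → (windowCount κ σ X : ℝ) ≤ C * X ^ δ :=
  no_witness_of_sigma_le_six

example (K' : ℝ) (hK' : 3 ≤ K') : 9 * (K' + 2) ≤ (K' + 1) * (2 * (K' + 2) + 3) := by nlinarith

/-- Load-bearing analysis (landed): without `3 < κ` a junk witness exists — the InertBox witness
keeps all three constraints. -/
example : ∃ κ σ δ C : ℝ, κ < σ ∧ δ < (σ - κ) / (2 * σ - 6) ∧
    ∀ X : ℝ, 1 ≤ X → (windowCount κ σ X : ℝ) ≤ C * X ^ δ :=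
  someWindowSaving_trivial_without_lowerKappa

end Summit.ABC.ABC.Cruxes.SomeWindowSaving.PolynomialDegreeSuffices

end
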